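import Summits.QuantumFields.BalabanUV.Beta.GAN24.S3DiffV
import Summits.QuantumFields.BalabanUV.Beta.GAN24.ThreeKernelRowVBoundSymAn1At
import Summits.QuantumFields.BalabanUV.Beta.GAN24.DecimatedKernelLegsSymAn1At

/-!
# Road S3, **DIFF ROW R3-dV FOR an1's SYMMETRISED BORDER TABLE `borderSum (Lc^(m+1)) (symVhSAt (toSite r) 3 Lc)`** — part (c) ⇒ END **`diffV_three_at`**:
# `∃ cV θ ρ, 0 ≤ cV ∧ 0 ≤ θ < 1 ∧ 0 ≤ ρ < 1 ∧ ∀ r ∈ box (3+1) Lc, ∀ m < n, ∀ κ′ u′, SupBound (member (n+3, m+2)'s unit-rescaled pushed border piece − member (n+2, m+1)'s)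
# (cV·θ^{n+1}·ρ^{n−m})` — UNCONDITIONAL at `d = 3`, `2 ≤ Lc`, the SAME constants as the base row, constants BEFORE the root (An1 twin of road-P2 g33's `S3DiffVSymAt`;
# corner-root base leaf-03 g15's `S3DiffV` BY NAME)

NOT IN PRINT — OUR BOOKKEEPING (road-P2 = `b2b-balaban-gan24-p2` gen 56, 2026-08-25; row G-an2-4 ∕ (CONV-C), the (α-0) chain at row D1's literal
OF RECORD (III′) `JsB12CombShSym`; [folklore] composition BY NAME; 0 `def`, 0 cite, 0 `def … : Prop`, 0 `sorry`).  Weight 0.  NEVER «G-an2-4 closed» as (CONV-C);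
NOT D1, NOT BetaPertH, NOT continuum, NOT Clay; NO campaign opened (an2 W-4) — typed while idle under R-2 as a brick of the located «SYM-S3-V-DIFF» transfer
(the RAW UNDRESSED top-aligned V PAIR letter of the (III′) V-born RATE half `hBd-V`, road-P2 MEMO M-gan24p2-g56-1, `gen56/S-CAMPAIGN-SIZING-g56.v0_7.md` §2(d)).

NAMING: in the existing (E) files «Sym» (`…SymAt`) = the UN-NEGATED rooted border `vhSAt ρ` (the OWNER's W15); «An1» (this file) = an1's (0.4)-SYMMETRISED border
`SymAveragingHessianCounts.symVhSAt ρ` — the type of the record field `SymTables.V`.  METHOD = road-P2's `tools/mkstab.py` (the OWNER gan24-p1's gen-6 `mkroot.py`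
rule): the (E) «Sym» file VERBATIM with `vhSAt (toSite r) d Lc ↦ symVhSAt (toSite r) d Lc` — the symmetrised border has the SAME support ∕ entry ∕ locality letters
(`symVhKerAt_eq_zero_left ∕ _right`, `abs_symVhKerAt_le ≤ 3ℓ²`, `locStencil_symVhSAt`) and the SAME `rfl`-zero ff ∕ mm blocks (accessors `TaylorMassVHAn1At.symVhSAt_inl_inl ∕
_inr_inr`, M.78); every table-free lemma of the base modules is used BY NAME (not re-declared); same theorem names in this file's namespace; base and «Sym» modules
untouched; no zero-root sanity `example`.  Discharges NOTHING of (hS, hSall), the K-slot, hBdev or BetaPertH by itself.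

## Contents (root `r ∈ box (d+1) Lc`)
`diffV_three_of_decLegs_at` (from the `Lc`-decimated leg letters), `diffV_three_of_cellMean_at` («(N1-Cauchy)» in cell-mean currency), END **`diffV_three_at (hLc : 2 ≤ Lc) (cVH)`**
— UNCONDITIONAL (`KSlotAssembly.convCKWall_holds`, `FineReadoutCauchyDecLegs.decLegs_three_of_cellMean`, exactly as at (E)).  It is the births-`≥ 1`, lengths-`≥ 2` RAW
UNDRESSED instance of the V pair letter of the (III′) V rate socket (comb twin ahead: `CombBornBorderDriftAssembly`); the CONTACT pairs are NOT here.
-/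

noncomputable section

open Finset
open scoped BigOperators
open Literature.MathematicalPhysics.QuantumFieldTheory
open Literature.MathematicalPhysics.QuantumFieldTheory.Balaban1983to89
open Literature.MathematicalPhysics.QuantumFieldTheory.Balaban1983to89.Beta
open LatticeForm (quo)
open B12Sec2to5 (l1 l1_nonneg)
open ExpKernelCalculus (MKer Decays Zl Zl_pos)
open KernelSpecInstance (wH)
open KKTFluctuationKernel (GamΦ)
open OneStepResolventKernel (Fib LocStencil KInv decays_KInv decays_mono)
open OneStepKernelFamily (dec legSet legW legPt)
open AveragingHessianKernels (ell)
open BalabanStepJets (locStencil_mono)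
open BalabanCompositeJets (pushSum)
open DecLiftAdjoint (borderSum)
open Summit.QuantumFields.BalabanUV.Beta.SymAveragingHessianCounts (symVhSAt symVhKerAt symVhKerAt_eq_zero_left symVhKerAt_eq_zero_right abs_symVhKerAt_le
  locStencil_symVhSAt symVhSAt_symm)
open Summit.QuantumFields.BalabanUV.Beta.HessKerDressedUnits (unitK)
open Summit.QuantumFields.BalabanUV.Beta.GAN24.CombesThomas (SupBound CauchyDecayK sfStep smStep)
open Summit.QuantumFields.BalabanUV.Beta.GAN24.E3UnitSplit (e3OfS e3OfS_inl_inr e3OfS_inr)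
open Summit.QuantumFields.BalabanUV.Beta.GAN24.ThirdJetThreeKernel (e3K3 e3OfS_eq_e3K3 e3K3_sub_telescope)
open Summit.QuantumFields.BalabanUV.Beta.GAN24.DilatedBorderThirdJet (locStencil_smul')
open Summit.QuantumFields.BalabanUV.Beta.GAN24.ThreeKernelRowVBoundSymAn1At (abs_entry3_le)
open Summit.QuantumFields.BalabanUV.Beta.GAN24.DecimatedKernelLegs (decays_unitK_dec_KInv)
open Summit.QuantumFields.BalabanUV.Beta.GAN24.DecimatedKernelLegsSymAn1At (succ_piece_eq_e3K3_unitK_at locStencil_pushSum_borderSumV_one)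
open Summit.QuantumFields.BalabanUV.Beta.GAN24.S3DiffV (abs_add₃_le mul_mul_le_of_le_one)
open Summit.QuantumFields.BalabanUV.Beta.GAN24.S3DiffVLegs
open Summit.QuantumFields.BalabanUV.Beta.GAN24.StencilSlotE3PhiLeg (phiLeg_three)
open Summit.QuantumFields.BalabanUV.Beta.GAN24.StencilSlotE3HLeg (legs_three)
open Summit.QuantumFields.BalabanUV.Beta.GAN24.KSlotAssembly (convCKWall_holds)
open Summit.QuantumFields.BalabanUV.Beta.GAN24.FineReadoutCauchyDecLegs (decLegs_three_of_cellMean)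
open Summit.QuantumFields.BalabanUV.Beta.GAN24.FineReadoutCauchyHolds (exists_wH_cellMean_cauchy)
open AffineAveraging (box toSite)

namespace Summit.QuantumFields.BalabanUV.Beta.GAN24.S3DiffVSymAn1At

variable {Lc : ℕ} [NeZero Lc]

/-- **ROW R3-dV AT `d = 3`, ROOTED SYMMETRIC TABLE, AT EVERY IN-BLOCK ROOT (constants BEFORE the root), AS A FUNCTION OF THE DECIMATED «(N1-Cauchy)» LEG DIFFERENCES** (the hypothesis `dV` of
`StencilSlotE3RateOfPieces.e3SupRate_of_pieces`, statement copied from staged 33c3b428985b41f4 ∕ typer stub `S3.DiffV 3 Lc cVH cV θ ρ`, VERBATIM, with the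
row's own `0 ≤ θ < 1`, `0 ≤ ρ < 1`, `0 ≤ cV`; NOT IN PRINT; [folklore] over parts 1–5 + the tree's leg packages).  Hypotheses `hDH`∕`hDG` = the two conjuncts of
leaf-19-g15's `FineReadoutCauchyDecLegs.decLegs_three_of_cellMean` (with its `0 ≤ c′`, `0 ≤ θ′ < 1`, `0 < κ′`).  Discharges NOTHING of «E3SupRate» by itself
(one hypothesis of ten); NOT BetaPertH, NOT continuum, NOT Clay. -/
theorem diffV_three_of_decLegs_at (hLc : 2 ≤ Lc) (cVH : ℝ) {c' θ' κ' : ℝ} (hc' : 0 ≤ c') (hθ'0 : 0 ≤ θ') (hθ'1 : θ' < 1) (hκ' : 0 < κ')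
    (hDH : ∀ (n : ℕ) (k l : Fin (3 + 1)) (u u' : Fin (3 + 1) → ℤ),
      |∑ i ∈ legSet 3 Lc (Sum.inl k), legW 3 Lc (Sum.inl k) *
            (((Lc : ℝ) ^ (n + 1 + 1 + 1)) ^ (3 + 2) *
              wH (N := Lc ^ (n + 1 + 1 + 1)) k l (legPt Lc (Sum.inl k) u i - (((Lc ^ (n + 1 + 1 + 1) : ℕ) : ℤ)) • u')) -
          ((Lc : ℝ) ^ (n + 1 + 1)) ^ (3 + 2) * wH (N := Lc ^ (n + 1 + 1)) k l (u - (((Lc ^ (n + 1 + 1) : ℕ) : ℤ)) • u')|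
        ≤ c' * θ' ^ (n + 1) * Real.exp (-κ' * l1 (quo (Lc ^ (n + 1 + 1)) u - u')))
    (hDG : ∀ (n : ℕ) (α l : Fin (3 + 1)) (x' w : Fin (3 + 1) → ℤ),
      |∑ i ∈ legSet 3 Lc (Sum.inl l), legW 3 Lc (Sum.inl l) *
            (((Lc : ℝ) ^ (n + 1 + 1 + 1)) ^ (3 + 2) * GamΦ (N := Lc ^ (n + 1 + 1 + 1)) α x' l (legPt Lc (Sum.inl l) w i)) -
          ((Lc : ℝ) ^ (n + 1 + 1)) ^ (3 + 2) * GamΦ (N := Lc ^ (n + 1 + 1)) α x' l w|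
        ≤ c' * θ' ^ (n + 1) * Real.exp (-κ' * l1 (x' - quo (Lc ^ (n + 1 + 1)) w))) :
    ∃ cV θ ρ : ℝ, 0 ≤ cV ∧ 0 ≤ θ ∧ θ < 1 ∧ 0 ≤ ρ ∧ ρ < 1 ∧
      ∀ (r : Fin (3 + 1) → ℕ), r ∈ box (3 + 1) Lc → ∀ (n m : ℕ), m < n → ∀ (κ' : Fin (3 + 1)) (u' : Fin (3 + 1) → ℤ), SupBound (fun x z a b =>
        ((Lc : ℝ) ^ (n + 1 + 1 + 1)) ^ (2 * (3 + 1)) * e3OfS (Lc ^ (n + 1 + 1 + 1))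
            (fun κ u => ((((Lc : ℝ) ^ (3 + 1)) ^ (n - m) * (cVH * ((Lc : ℝ) ^ (m + 1 + 1)) ^ (3 + 2))) •
              pushSum (Lc ^ (m + 1 + 1 + 1)) (Lc ^ (n - m)) (borderSum (Lc ^ (m + 1 + 1)) (fun κ₀ z₀ => symVhSAt (toSite r) 3 Lc rfl κ₀ z₀) κ u))) κ' u' x z a b -
          ((Lc : ℝ) ^ (n + 1 + 1)) ^ (2 * (3 + 1)) * e3OfS (Lc ^ (n + 1 + 1))
            (fun κ u => ((((Lc : ℝ) ^ (3 + 1)) ^ (n - m) * (cVH * ((Lc : ℝ) ^ (m + 1)) ^ (3 + 2))) •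
              pushSum (Lc ^ (m + 1 + 1)) (Lc ^ (n - m)) (borderSum (Lc ^ (m + 1)) (fun κ₀ z₀ => symVhSAt (toSite r) 3 Lc rfl κ₀ z₀) κ u))) κ' u' x z a b)
        (cV * θ ^ (n + 1) * ρ ^ (n - m)) := by
  -- (0) the leg packages of the tree
  obtain ⟨CΦ, δΦ, hδΦ, hCΦ, hΦ₁, hΦ₂⟩ := phiLeg_three (Lc := Lc)
  obtain ⟨CH, κH, hκH, hCH, hH, hG⟩ := legs_three (Lc := Lc)
  obtain ⟨CK, δK, cK, θK, hδK, hθK0, hθK1, _hKu, hKall⟩ := convCKWall_holds hLc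
  have hcK : 0 ≤ cK := by
    have h := (hKall 0 0).nonneg (Sum.inl 0)
    simpa only [pow_zero, mul_one] using h
  have hL1 : 1 ≤ Lc := le_trans (by norm_num) hLc
  have hLpos : (0 : ℝ) < Lc := by exact_mod_cast Nat.lt_of_lt_of_le Nat.zero_lt_one hL1
  have hL1r : (1 : ℝ) < Lc := by exact_mod_cast Nat.lt_of_lt_of_le (by norm_num) hLc
  -- common rate (opaque)
  obtain ⟨κ₀, hκ₀def⟩ : ∃ κ₀ : ℝ, κ₀ = min (min δΦ κH) (min δK κ') := ⟨_, rfl⟩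
  have hκ₀ : 0 < κ₀ := by rw [hκ₀def]; exact lt_min (lt_min hδΦ hκH) (lt_min hδK hκ')
  have hκ₀Φ : κ₀ ≤ δΦ := by rw [hκ₀def]; exact (min_le_left _ _).trans (min_le_left _ _)
  have hκ₀H : κ₀ ≤ κH := by rw [hκ₀def]; exact (min_le_left _ _).trans (min_le_right _ _)
  have hκ₀K : κ₀ ≤ δK := by rw [hκ₀def]; exact (min_le_right _ _).trans (min_le_left _ _)
  have hκ₀' : κ₀ ≤ κ' := by rw [hκ₀def]; exact (min_le_right _ _).trans (min_le_right _ _)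
  -- the row's rate and ratio (opaque)
  obtain ⟨θ, hθdef⟩ : ∃ θ : ℝ, θ = max θK θ' := ⟨_, rfl⟩
  have hθ0 : 0 ≤ θ := by rw [hθdef]; exact hθK0.trans (le_max_left _ _)
  have hθ1 : θ < 1 := by rw [hθdef]; exact max_lt hθK1 hθ'1
  have hθKle : θK ≤ θ := by rw [hθdef]; exact le_max_left _ _
  have hθ'le : θ' ≤ θ := by rw [hθdef]; exact le_max_right _ _
  obtain ⟨ρ, hρdef⟩ : ∃ ρ : ℝ, ρ = (Lc : ℝ)⁻¹ := ⟨_, rfl⟩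
  have hρ0 : 0 ≤ ρ := by rw [hρdef]; exact inv_nonneg.2 hLpos.le
  have hρ1 : ρ < 1 := by rw [hρdef]; exact inv_lt_one_of_one_lt₀ hL1r
  have hZL : 0 ≤ Zl (3 + 1) (κ₀ / 2) := (Zl_pos (half_pos hκ₀)).le
  have hS0 : 0 ≤ (Lc : ℝ) ^ (2 * (3 + 1)) * cK * ((CH + c') * (CH + c') + CH * CH) + c' * CΦ * (2 * (CH + c') + 2 * CH) := by positivity
  refine ⟨|cVH| * (((3 : ℕ) : ℝ) + 1) ^ 3 *
      ((Lc : ℝ) ^ (2 * (3 + 1)) * cK * ((CH + c') * (CH + c') + CH * CH) + c' * CΦ * (2 * (CH + c') + 2 * CH)) *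
      ((((2 * (2 * (3 + 1) * (Lc + 1) + (2 * 3 + 3)) + 1) ^ (3 + 1) : ℕ) : ℝ) ^ 2 * (3 * (ell (3 + 1) Lc : ℝ) ^ 2)) *
      Real.exp (κ₀ * (2 * ((2 * (3 + 1) * (Lc + 1) + (2 * 3 + 3) : ℕ) : ℝ) + 4 * (((3 : ℕ) : ℝ) + 1))) *
      Zl (3 + 1) (κ₀ / 2) * (((Lc : ℝ) ^ (3 + 1))⁻¹ * ((Lc : ℝ) ^ 2)⁻¹),
    θ, ρ, by positivity, hθ0, hθ1, hρ0, hρ1, fun r hr n m hmn κ' u' => ?_⟩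
  obtain ⟨k, hk⟩ := Nat.exists_eq_add_of_lt hmn
  have ek : n - m = k + 1 := by omega
  have hp : n + 1 + 1 = m + k + 1 + 1 + 1 := by omega
  intro x z a b
  dsimp only
  rcases a with α | μ
  · rcases b with β | ν
    · -- (1) both members as the three-leg functional of member `n+2`'s table
      rw [succ_piece_eq_e3K3_unitK_at (d := 3) hL1 hr cVH n m κ' u' x z (Sum.inl α) (Sum.inl β), e3OfS_eq_e3K3, ← mul_sub, ek]
      -- (2) telescoping (decay data only for the identity)
      obtain ⟨δ1, C1, hδ1, hC1, hK1⟩ := decays_KInv (N := Lc ^ (n + 1 + 1)) (d := 3)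
      obtain ⟨δ2, C2, hδ2, hC2, hK2⟩ := decays_unitK_dec_KInv (d := 3) (Lc := Lc) (N' := Lc ^ (n + 1 + 1 + 1))
      have hδc : 0 < min (min δ1 δ2) 1 := lt_min (lt_min hδ1 hδ2) one_pos
      have hK1' := decays_mono hK1 hC1 le_rfl ((min_le_left _ _).trans (min_le_left _ _) : min (min δ1 δ2) 1 ≤ δ1)
      have hK2' := decays_mono hK2 hC2 le_rfl ((min_le_left _ _).trans (min_le_right _ _) : min (min δ1 δ2) 1 ≤ δ2)
      have hLk : 1 ≤ Lc ^ (k + 1) := Nat.one_le_pow _ _ (Nat.lt_of_lt_of_le Nat.zero_lt_one hL1)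
      have hT0 := locStencil_smul' (locStencil_pushSum_borderSumV_one (d := 3) hL1 hr (Lc ^ (m + 1)) (Lc ^ (m + 1 + 1)) (Lc ^ (k + 1)) hLk)
        (((Lc : ℝ) ^ (3 + 1)) ^ (k + 1) * (cVH * ((Lc : ℝ) ^ (m + 1)) ^ (3 + 2)))
      have hT := locStencil_mono hT0 ((hT0 0 0).nonneg (Sum.inl 0)) (min_le_right (min δ1 δ2) 1)
      rw [e3K3_sub_telescope hK1' hK2' hK1' hK2' hK1' hK2' hT hδc le_rfl (Lc ^ (n + 1 + 1)) κ' u' x z (Sum.inl α) (Sum.inl β),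
        mul_add, mul_add]
      -- (3) the three one-difference-leg terms
      have b1 := abs_entry3_le (d := 3) hL1 hκ₀ _ _ _ m k (n + 1 + 1) hp
        (legD_mm_left hκ₀.le hκ₀K hcK hθK0 hKall n) (legD_mf hκ₀' hDG n)
        (legKn_fm hκ₀H hκ₀' hc' hθ'0 hθ'1.le hH hDH n) (fun l β y z' => legKn_fm hκ₀H hκ₀' hc' hθ'0 hθ'1.le hH hDH n l β y z')
        (fun l β y z' => legKn_mm_right hκ₀Φ hΦ₂ n y z' l β) hr cVH κ' u' x z α β
      have b2 := abs_entry3_le (d := 3) hL1 hκ₀ _ _ _ m k (n + 1 + 1) hp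
        (legK_mm_left hκ₀Φ hΦ₁ n) (legK_mf hκ₀H hG n)
        (legD_fm hκ₀' hDH n) (fun l β y z' => legKn_fm hκ₀H hκ₀' hc' hθ'0 hθ'1.le hH hDH n l β y z')
        (fun l β y z' => legKn_mm_right hκ₀Φ hΦ₂ n y z' l β) hr cVH κ' u' x z α β
      have b3 := abs_entry3_le (d := 3) hL1 hκ₀ _ _ _ m k (n + 1 + 1) hp
        (legK_mm_left hκ₀Φ hΦ₁ n) (legK_mf hκ₀H hG n)
        (legK_fm hκ₀H hH n) (fun l β y z' => legD_fm hκ₀' hDH n l β y z')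
        (fun l β y z' => legD_mm_right hκ₀.le hκ₀K hcK hθK0 hKall n y z' l β) hr cVH κ' u' x z α β
      -- (4) combine: every bound is `(leg factor) × R`, `R` the common nonnegative rest
      have hE1 : Real.exp (-(κ₀ / 2) * (l1 (x - u') + l1 (z - u'))) ≤ 1 := by
        rw [Real.exp_le_one_iff]
        have h1 := l1_nonneg (x - u')
        have h2 := l1_nonneg (z - u')
        have : 0 ≤ κ₀ / 2 * (l1 (x - u') + l1 (z - u')) := by positivity
        linarith
      have hR : 0 ≤ |cVH| * (((3 : ℕ) : ℝ) + 1) ^ 3 *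
          ((((2 * (2 * (3 + 1) * (Lc + 1) + (2 * 3 + 3)) + 1) ^ (3 + 1) : ℕ) : ℝ) ^ 2 * (3 * (ell (3 + 1) Lc : ℝ) ^ 2)) *
          Real.exp (κ₀ * (2 * ((2 * (3 + 1) * (Lc + 1) + (2 * 3 + 3) : ℕ) : ℝ) + 4 * (((3 : ℕ) : ℝ) + 1))) *
          Zl (3 + 1) (κ₀ / 2) * (((Lc : ℝ) ^ (3 + 1))⁻¹ * ((Lc : ℝ) ^ 2)⁻¹) * ((Lc : ℝ)⁻¹) ^ (k + 1) *
          Real.exp (-(κ₀ / 2) * (l1 (x - u') + l1 (z - u'))) := by positivity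
      have hθKn : θK ^ (n + 1) ≤ θ ^ (n + 1) := pow_le_pow_left₀ hθK0 hθKle _
      have hθ'n : θ' ^ (n + 1) ≤ θ ^ (n + 1) := pow_le_pow_left₀ hθ'0 hθ'le _
      have hsum : ((CH + c') * (CH + c') * ((Lc : ℝ) ^ (2 * (3 + 1)) * cK * θK ^ (n + 1)) + c' * θ' ^ (n + 1) * (CH + c') * CΦ) +
          ((CH + c') * (c' * θ' ^ (n + 1)) * CΦ + CH * (c' * θ' ^ (n + 1)) * CΦ) +
          (c' * θ' ^ (n + 1) * CH * CΦ + CH * CH * ((Lc : ℝ) ^ (2 * (3 + 1)) * cK * θK ^ (n + 1))) ≤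
          θ ^ (n + 1) * ((Lc : ℝ) ^ (2 * (3 + 1)) * cK * ((CH + c') * (CH + c') + CH * CH) + c' * CΦ * (2 * (CH + c') + 2 * CH)) := by
        have e : ((CH + c') * (CH + c') * ((Lc : ℝ) ^ (2 * (3 + 1)) * cK * θK ^ (n + 1)) + c' * θ' ^ (n + 1) * (CH + c') * CΦ) +
            ((CH + c') * (c' * θ' ^ (n + 1)) * CΦ + CH * (c' * θ' ^ (n + 1)) * CΦ) +
            (c' * θ' ^ (n + 1) * CH * CΦ + CH * CH * ((Lc : ℝ) ^ (2 * (3 + 1)) * cK * θK ^ (n + 1))) =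
            θK ^ (n + 1) * ((Lc : ℝ) ^ (2 * (3 + 1)) * cK * ((CH + c') * (CH + c') + CH * CH)) +
              θ' ^ (n + 1) * (c' * CΦ * (2 * (CH + c') + 2 * CH)) := by ring
        rw [e]
        have hA : 0 ≤ (Lc : ℝ) ^ (2 * (3 + 1)) * cK * ((CH + c') * (CH + c') + CH * CH) := by positivity
        have hB : 0 ≤ c' * CΦ * (2 * (CH + c') + 2 * CH) := by positivity
        have h := add_le_add (mul_le_mul_of_nonneg_right hθKn hA) (mul_le_mul_of_nonneg_right hθ'n hB)
        have e2 : θ ^ (n + 1) * ((Lc : ℝ) ^ (2 * (3 + 1)) * cK * ((CH + c') * (CH + c') + CH * CH)) +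
            θ ^ (n + 1) * (c' * CΦ * (2 * (CH + c') + 2 * CH)) =
            θ ^ (n + 1) * ((Lc : ℝ) ^ (2 * (3 + 1)) * cK * ((CH + c') * (CH + c') + CH * CH) + c' * CΦ * (2 * (CH + c') + 2 * CH)) := by
          ring
        rw [← e2]
        exact h
      have key := abs_add₃_le
        (c₁ := (CH + c') * (CH + c') * ((Lc : ℝ) ^ (2 * (3 + 1)) * cK * θK ^ (n + 1)) + c' * θ' ^ (n + 1) * (CH + c') * CΦ)
        (c₂ := (CH + c') * (c' * θ' ^ (n + 1)) * CΦ + CH * (c' * θ' ^ (n + 1)) * CΦ)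
        (c₃ := c' * θ' ^ (n + 1) * CH * CΦ + CH * CH * ((Lc : ℝ) ^ (2 * (3 + 1)) * cK * θK ^ (n + 1)))
        (R := |cVH| * (((3 : ℕ) : ℝ) + 1) ^ 3 *
          ((((2 * (2 * (3 + 1) * (Lc + 1) + (2 * 3 + 3)) + 1) ^ (3 + 1) : ℕ) : ℝ) ^ 2 * (3 * (ell (3 + 1) Lc : ℝ) ^ 2)) *
          Real.exp (κ₀ * (2 * ((2 * (3 + 1) * (Lc + 1) + (2 * 3 + 3) : ℕ) : ℝ) + 4 * (((3 : ℕ) : ℝ) + 1))) *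
          Zl (3 + 1) (κ₀ / 2) * (((Lc : ℝ) ^ (3 + 1))⁻¹ * ((Lc : ℝ) ^ 2)⁻¹) * ((Lc : ℝ)⁻¹) ^ (k + 1) *
          Real.exp (-(κ₀ / 2) * (l1 (x - u') + l1 (z - u'))))
        (b1.trans (le_of_eq (by ring))) (b2.trans (le_of_eq (by ring))) (b3.trans (le_of_eq (by ring))) hsum hR
      refine key.trans ?_
      rw [hρdef]
      have hA : 0 ≤ |cVH| * (((3 : ℕ) : ℝ) + 1) ^ 3 *
          ((((2 * (2 * (3 + 1) * (Lc + 1) + (2 * 3 + 3)) + 1) ^ (3 + 1) : ℕ) : ℝ) ^ 2 * (3 * (ell (3 + 1) Lc : ℝ) ^ 2)) *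
          Real.exp (κ₀ * (2 * ((2 * (3 + 1) * (Lc + 1) + (2 * 3 + 3) : ℕ) : ℝ) + 4 * (((3 : ℕ) : ℝ) + 1))) *
          Zl (3 + 1) (κ₀ / 2) * (((Lc : ℝ) ^ (3 + 1))⁻¹ * ((Lc : ℝ) ^ 2)⁻¹) * ((Lc : ℝ)⁻¹) ^ (k + 1) := by positivity
      have hT : 0 ≤ θ ^ (n + 1) *
          ((Lc : ℝ) ^ (2 * (3 + 1)) * cK * ((CH + c') * (CH + c') + CH * CH) + c' * CΦ * (2 * (CH + c') + 2 * CH)) := by positivity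
      have hfin := mul_mul_le_of_le_one hT hA hE1
      refine (le_of_eq ?_).trans (hfin.trans (le_of_eq ?_))
      · ring
      · ring
    · rw [e3OfS_inl_inr, e3OfS_inl_inr, mul_zero, mul_zero, sub_zero, abs_zero]
      positivity
  · rw [e3OfS_inr, e3OfS_inr, mul_zero, mul_zero, sub_zero, abs_zero]
    positivity


/-- **ROW R3-dV AT `d = 3`, ROOTED SYMMETRIC TABLE, FROM THE CELL-MEAN «(N1-Cauchy)»** (owner's `N1-CAUCHY-SPEC.md` §1 VERBATIM as the hypothesis `hC`; leaf-19-g15's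
`FineReadoutCauchyDecLegs.decLegs_three_of_cellMean` BY NAME supplies the decimated leg differences).  NOT IN PRINT; [folklore] composition. -/
theorem diffV_three_of_cellMean_at (hLc : 2 ≤ Lc) (cVH : ℝ) {c θ κ₁ : ℝ} (hc : 0 ≤ c) (hθ0 : 0 ≤ θ) (hθ1 : θ < 1) (hκ₁ : 0 < κ₁)
    (hC : ∀ (n : ℕ) (κ l : Fin (3 + 1)) (z : Fin (3 + 1) → ℤ),
      |((Lc : ℝ) ^ (3 + 1))⁻¹ * ∑ r ∈ box (3 + 1) Lc,
            ((Lc : ℝ) ^ (n + 2)) ^ (3 + 2) * wH (N := Lc ^ (n + 2)) κ l ((Lc : ℤ) • z + toSite r) -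
          ((Lc : ℝ) ^ (n + 1)) ^ (3 + 2) * wH (N := Lc ^ (n + 1)) κ l z| ≤
        c * θ ^ n * Real.exp (-κ₁ * l1 (quo (Lc ^ (n + 1)) z))) :
    ∃ cV θ ρ : ℝ, 0 ≤ cV ∧ 0 ≤ θ ∧ θ < 1 ∧ 0 ≤ ρ ∧ ρ < 1 ∧
      ∀ (r : Fin (3 + 1) → ℕ), r ∈ box (3 + 1) Lc → ∀ (n m : ℕ), m < n → ∀ (κ' : Fin (3 + 1)) (u' : Fin (3 + 1) → ℤ), SupBound (fun x z a b =>
        ((Lc : ℝ) ^ (n + 1 + 1 + 1)) ^ (2 * (3 + 1)) * e3OfS (Lc ^ (n + 1 + 1 + 1))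
            (fun κ u => ((((Lc : ℝ) ^ (3 + 1)) ^ (n - m) * (cVH * ((Lc : ℝ) ^ (m + 1 + 1)) ^ (3 + 2))) •
              pushSum (Lc ^ (m + 1 + 1 + 1)) (Lc ^ (n - m)) (borderSum (Lc ^ (m + 1 + 1)) (fun κ₀ z₀ => symVhSAt (toSite r) 3 Lc rfl κ₀ z₀) κ u))) κ' u' x z a b -
          ((Lc : ℝ) ^ (n + 1 + 1)) ^ (2 * (3 + 1)) * e3OfS (Lc ^ (n + 1 + 1))
            (fun κ u => ((((Lc : ℝ) ^ (3 + 1)) ^ (n - m) * (cVH * ((Lc : ℝ) ^ (m + 1)) ^ (3 + 2))) •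
              pushSum (Lc ^ (m + 1 + 1)) (Lc ^ (n - m)) (borderSum (Lc ^ (m + 1)) (fun κ₀ z₀ => symVhSAt (toSite r) 3 Lc rfl κ₀ z₀) κ u))) κ' u' x z a b)
        (cV * θ ^ (n + 1) * ρ ^ (n - m)) := by
  obtain ⟨c', θ', κ', h0, h1, h2, h3, hDH, hDG⟩ := decLegs_three_of_cellMean (Lc := Lc) hLc hc hθ0 hθ1 hκ₁ hC
  exact diffV_three_of_decLegs_at hLc cVH h0 h1 h2 h3 hDH hDG

/-- **ROW R3-dV OF THE S3 RATE TABLE AT `d = 3` FOR THE ROOTED SYMMETRIC TABLE, AT EVERY IN-BLOCK ROOT, UNCONDITIONALLY** (`Lc ≥ 2`, every colour weight `cVH`;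
the top-aligned UNDRESSED V PAIR `(k+1, i+1) − (k, i)` of the born-V rate socket for `k ≥ i+2` is `Lc^4 ×` this row through the owner's `lineage_v_succ_pin_apply`): the hypothesis `dV` of
`StencilSlotE3RateOfPieces.e3SupRate_of_pieces` (statement copied from staged 33c3b428985b41f4 = tree p207016; typer stub `S3.DiffV 3 Lc cVH cV θ ρ`),
VERBATIM, with the row's own `cV ≥ 0`, `θ = max θ_K θ′ ∈ [0,1)`, `ρ = Lc⁻¹ ∈ [0,1)` — from road P1's CLOSED K-slot (`KSlotAssembly.convCKWall_holds`), the
`Φ̃`∕`H̃`∕`G̃` leg packages (`StencilSlotE3PhiLeg.phiLeg_three`, `StencilSlotE3HLeg.legs_three` over leaf-16's (N1)), leaf-17's «(N1-Cauchy)»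
`FineReadoutCauchyHolds.exists_wH_cellMean_cauchy` and leaf-19's decimated packaging, through parts 1–5 of this row.  NOT IN PRINT; OUR PROOF.  ONE of the
seventeen PART III rows (one hypothesis of `e3SupRate_of_pieces`); discharges NOTHING else of «E3SupRate»/«E3Shape», (hS, hSall), (hW, hWall), window,
(D1); NEVER «G-an2-4 closed»; NOT BetaPertH, NOT continuum, NOT Clay. -/
theorem diffV_three_at (hLc : 2 ≤ Lc) (cVH : ℝ) :
    ∃ cV θ ρ : ℝ, 0 ≤ cV ∧ 0 ≤ θ ∧ θ < 1 ∧ 0 ≤ ρ ∧ ρ < 1 ∧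
      ∀ (r : Fin (3 + 1) → ℕ), r ∈ box (3 + 1) Lc → ∀ (n m : ℕ), m < n → ∀ (κ' : Fin (3 + 1)) (u' : Fin (3 + 1) → ℤ), SupBound (fun x z a b =>
        ((Lc : ℝ) ^ (n + 1 + 1 + 1)) ^ (2 * (3 + 1)) * e3OfS (Lc ^ (n + 1 + 1 + 1))
            (fun κ u => ((((Lc : ℝ) ^ (3 + 1)) ^ (n - m) * (cVH * ((Lc : ℝ) ^ (m + 1 + 1)) ^ (3 + 2))) •
              pushSum (Lc ^ (m + 1 + 1 + 1)) (Lc ^ (n - m)) (borderSum (Lc ^ (m + 1 + 1)) (fun κ₀ z₀ => symVhSAt (toSite r) 3 Lc rfl κ₀ z₀) κ u))) κ' u' x z a b -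
          ((Lc : ℝ) ^ (n + 1 + 1)) ^ (2 * (3 + 1)) * e3OfS (Lc ^ (n + 1 + 1))
            (fun κ u => ((((Lc : ℝ) ^ (3 + 1)) ^ (n - m) * (cVH * ((Lc : ℝ) ^ (m + 1)) ^ (3 + 2))) •
              pushSum (Lc ^ (m + 1 + 1)) (Lc ^ (n - m)) (borderSum (Lc ^ (m + 1)) (fun κ₀ z₀ => symVhSAt (toSite r) 3 Lc rfl κ₀ z₀) κ u))) κ' u' x z a b)
        (cV * θ ^ (n + 1) * ρ ^ (n - m)) := by
  obtain ⟨c, θ, κ₁, hc, hθ0, hθ1, hκ₁, hC⟩ := exists_wH_cellMean_cauchy Lc hLc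
  exact diffV_three_of_cellMean_at hLc cVH hc hθ0 hθ1 hκ₁ hC

end Summit.QuantumFields.BalabanUV.Beta.GAN24.S3DiffVSymAn1At

end
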